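import Literature.AlgebraicGeometry.Resolution.PointBlowupMohBoundPrimePower
import Literature.AlgebraicGeometry.Resolution.PointBlowupKangaroo
import HarnessLib

/-!
# The package bound at order `pᵉ`: Hauser–Perlega's "modified Moh bound" (Lemma 2) over a
# monomialised sequence of point blow-ups, in fixed coordinates

Topic: `Literature/AlgebraicGeometry/Resolution`. Reproduction (cell `pub-hironaka`, unit
`b2b-hironaka-cp4`, DIM-4 CENSUS gen 18; sequel of `PointBlowupMohBoundPrimePower.lean`) of the
quantitative core of the surface resolution of

* H. Hauser, S. Perlega, *Resolving surface singularities in positive characteristic*, Publ. RIMS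
  Kyoto Univ. **60** (2024) 767–813 [HauserPerlega2024], §4 pp. 779–781 and §6 Lemma 2 pp. 789–790
  (read on the held text, PDF pages 13–15, 23–24). §4 p. 781 (PDF p. 15 L5–L13, L18, L33–L36):
  "Consider a sequence of `n` localized point blowups during which the component `V(y)` is
  preserved in the first `n − 1` blowups and lost in the `n`th blowup. Hence, the first `n − 1`
  blowups are given by local ring maps of the form `x ↦ x, y ↦ xy, z ↦ xz` and the last blowup is
  given by `x ↦ x, y ↦ x(y + t), z ↦ xz` for a non-zero constant `t ∈ K*`. … consider the parameter
  `ỹ = y + txⁿ` … This change of parameters monomializes the entire sequence of localized blowups. …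
  Introduce weights `ω(x) = 1` and `ω(ỹ) = n`. … let `d̃` be the order of `in_ω(F̃)` along the curve
  `V(z̃, ỹ)`. It can be shown in the same way as above that `d̃` bounds the residual order of the
  final strict transform of `X` at the end of the sequence of localized point blowups"; p. 780
  (PDF p. 14 L39–L44): "the number `d_t` is still bounded: For all `t ∈ K*`, the inequality
  `d_t ≤ d_res + p^{e−1}` holds, as will be seen in Lemma 2 below. Together we get
  `d′_res ≤ d_res + p^{e−1}`, as predicted by Moh's bound."
  **Lemma 2** (p. 789, PDF p. 23 L18–L21: "The following lemma is crucial to the remaining proofs …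
  It can be seen as a modified version of Moh's bound for the increase of the residual order under
  blowup [Moh87]"): "Let `𝓕 ∈ F` be a flag of the form `𝓕₂ = V(z₁)`, `𝓕₁ = V(z₁, y₁)`, where
  `y₁ = y + h(x)` and `z₁ = z + g(x, y)` is the change of parameters which eliminates all `pᵉ`-th
  powers from the expansion of `F` with respect to `x, y₁`. Assume that `n_𝓕 = ord h > 0` and set
  `n = n_𝓕`. Let `ω : K[[x, y]] → ℕ∞` be the weighted order that is defined by `ω(x) = 1` and
  `ω(y) = n`. Further, consider a factorization of the weighted initial form `in_ω(F)` of the form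
  `in_ω(F) = x^a y^b · H(x, y)`. Then the following inequality holds:
  `d_curv^𝓕 ≤ ord H + p^{e−1}` if `pᵉ` divides `ord_ω(F)`, `d_curv^𝓕 ≤ ord H` otherwise." Proof
  (p. 790, PDF p. 24 L11–L24): "If `ω(F)` is not divisible by `pᵉ`, then `G = 0` and
  `in_{ω₁}(F₁) = in_ω(F)` … `d_curv^𝓕 = ord_{(y₁)} in_ω(F) ≤ ord H` … Now assume that `pᵉ` divides
  `ω(F)`. Let `k < e` be maximal with the property that `in_ω(F)` is a `p^k`-th power. It is
  straightforward to verify that the derivative `∂_{y^{p^k}}(in_ω(F))` does not vanish. …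
  `d_curv^𝓕 = ord_{(y₁)} in_{ω₁}(F₁) ≤ ord_{(y₁)} ∂_{y₁^{p^k}}(in_{ω₁}(F₁)) + p^k
  = ord_{(y₁)} ∂_{y^{p^k}}(in_ω(F)) + p^k ≤ ord_{(y₁)} H₁ + p^k ≤ ord H + p^{e−1}`."
* T. T. Moh, *On a stability theorem for local uniformization in characteristic `p`*, Publ. RIMS
  **23** (1987) 965–973 [Moh1987] (the one-blow-up bound `+p^{e−1}`, in the tree as
  `PointBlowupMohBoundPrimePower.mohBound`); H. Hauser, S. Perlega, Publ. RIMS **55** (2019) =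
  arXiv:1906.09593 [HauserPerlega2019PRIMS], §5 (the Hasse-derivative proof of (9), the mechanism
  reused here).

## What is proved (every field `K` of characteristic `p`; model of `PointBlowupShade.lean`: fixed
## coordinates, states `s = (F, r)`, `step q j b`, cleaning = deletion of the `q`-th power
## monomials, `shade = ord₀ F − |r|`; `q = pᵉ`)

The **package** of length `m ≥ 1` in the `y_j`-chart is the sequence of states
`s_{n+1} = step q j 0 s_n` (`n + 1 < m`: blow-up of the origin of the `y_j`-chart — every old
component except `{y_j = 0}` is preserved) followed by `s_m = step q j b s_{m−1}` (a point `b` of the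
`y_j`-chart, `b_j = 0`), the order staying `≥ q` at `s_0, …, s_{m−1}`. For EVERY finite set `σ` of
residual variables (hypersurfaces `z^{pᵉ} + F(y)` of every dimension):

* §1–§4 (the monomialisation, [HP24] p. 781): with the PACKAGE WEIGHT `w_m(d) = d_j + m·Σ_{k≠j} d_k`
  (`pkgWeight`; `ω(y_j) = 1`, `ω(y_k) = m`) and the `m`-fold chart exponent
  `d^{(m)} = (w_m(d) − m·q; d_k)` (`pkgExponent`), the residual polynomial of `s_n` (`n < m`) is
  `F^{(n)} = Σ_d [y^d]F·y^{d^{(n)}}` (`pkgTransform`, `package_prefix`), the one of `s_m` is the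
  cleaning of `translate b (F^{(m)})`, no truncation occurs (`m·q ≤ w_m(d)` on the support), and
  `|r_m| = (w₀ − m·q) + Σ_{k≠j, b_k=0} r_k`, `w₀ = min_d w_m(d)` the weighted order `ord_ω(F)`
  (`minPkgWeight`, `package_closed_form`); `ord₀ F^{(m)} = w₀^{(m+1)} − m·q` (`ordZero_pkgTransform`).
* §5: the weighted initial form `In_ω F` (`pkgInitial`) carries the lowest `y_j`-layer
  `E_j = w₀ − m·q` of `translate b (F^{(m)})` (`coeff_translate_pkgTransform_layer`), and no
  monomial lies below it (`le_apply_of_mem_support_translate_pkgTransform`).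
* §6 **the Hasse probe across the package** (`exists_support_package_of_choose_ne_zero`): if
  `In_ω F` (or any weighted-homogeneous `P`) has a monomial `y^{d₀}` with
  `((d₀)_i choose p^k) ≢ 0 (mod p)`, `i ≠ j`, `k < e`, then the cleaned `translate b (P^{(m)})` has a
  monomial in the layer `E_j = w₀ − m·q` with `q ∤ E_i` and degree controlled by the layer lemma of
  `PointBlowupMohBound.lean` — `D^{(p^k·e_i)}` commutes with the translation
  (`hasseDeriv_translate`), acts diagonally on `P^{(m)}`, kills `q`-th powers; and the probe-free
  version when `q ∤ w₀` (`exists_support_package_of_not_dvd`, any natural `q`).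
* §7 **two residual variables** `y_j, y_i` (surfaces `z^{pᵉ} + F(y_j, y_i)`, [HP24]'s setting; the
  last point OFF the strict transform of `{y_i = 0}`, `b_i ≠ 0`, so that both components are lost
  at the last blow-up):
  - `exists_level`, `exists_choose_ne_zero_of_weight`: "`k < e` maximal with `in_ω(F)` a `p^k`-th
    power" exists for a clean `F ≠ 0`, and then "`∂_{y^{p^k}}(in_ω(F))` does not vanish" when
    `p^{k+1} ∣ ord_ω(F)` (weight argument);
  - **`shade_package_le_of_choose_ne_zero`**: `shade(s_m) ≤ (D − β) + p^k` whenever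
    `β ≤ d_i ≤ D` on the monomials `y^d` of `In_ω F` with `(d_i choose p^k) ≢ 0`;
  - **`shade_package_le_of_not_dvd`**: `shade(s_m) ≤ D − β` if `q ∤ w₀` and `β ≤ d_i ≤ D` on `In_ω F`;
  - **`shade_package_le`** — [HP24, Lemma 2] with the end-of-package estimate of §4, every `e ≥ 1`:
    `shade(s_m) ≤ (D − β) + p^{e−1}` whenever `β ≤ d_i ≤ D` on the monomials of `In_ω F` (take
    `β = min`, `D = max` of the `y_i`-exponents of `in_ω(F) = x^a y^b H`: then `D − β = deg_y H =
    ord H`, and the statement reads "`d′_res ≤ d̃ ≤ ord H + p^{e−1}`");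
  - `apply_add_le_of_mem_support_pkgInitial` ("`ord H ≤ d_res`": `d_i + r_j ≤ ord₀ F` on `In_ω F`)
    and **`shade_package_le_shade_add`**: hence `shade(s_m) ≤ shade(s_0) + p^{e−1}` — the crude form,
    which also follows from the one-step bound; the content of Lemma 2 is the sharper `D − β`,
    which can be much smaller than `shade(s_0)` (it is the `y_i`-height of the weighted initial form,
    not the order of the residual factor).

## Method (the printed proof of Lemma 2, transcribed to fixed coordinates)

[HP24] work in the flag `ỹ = y + txⁿ` of `𝒪̂_{W,a}` and clean there; the model blows up `m` times and
translates by the constant `b` at the end. The two are the same computation: on monomials,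
`translate b ∘ (m-fold chart) = (weighted chart) ∘ (y_i ↦ y_i + b_i y_j^m)`, so the weighted
initial form `in_ω` of the start governs the lowest `y_j`-layer of the end (§5), the substitution
`y₁ − txⁿ` becomes the constant translation `b` after the `m`-fold chart (whence the tree's
`hasseDeriv_translate` in place of property (2) "`∂_{x_i^k} = ∂_{y_i^k}` for `y_i = x_i + g`"), the
cleaning `z ↦ z₁` is the deletion of `q`-th power monomials (killed by `D^{(p^k e_i)}`, `k < e`:
property (3), `natCast_choose_prime_pow_eq_zero_of_pow_dvd`), and "`ord_{(y₁)} H₁ ≤ ord H`" is the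
layer lemma `exists_mem_support_translate_layer` (the unit `∏_{b_k ≠ 0}(y_k + b_k)^{ρ_k}` does not
contribute to the order). `ord_{ω₁}(F₁) = ord_ω(F)` is `ordZero_pkgTransform` /
`package_closed_form`; "`in_ω(F)(x, y₁ − txⁿ)` is not a `pᵉ`-th power" is
`deletePthPowers_pkgTransform` (cleanness survives the `m`-fold chart) together with the probe.

## What is NOT proved here (scope, honest)

* Lemma 2 for an ARBITRARY flag `y₁ = y + h(x)`, `h` a power series with `ord h = n` (the tree's
  named statement `HauserPerlega2024.TangentFlagBoundStatement` of `PointBlowupFlagInvariant.lean`,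
  typed over `MvPowerSeries` by the resolution observatory, is NOT discharged here): this file treats
  `h = t·xⁿ`, the flag that "monomializes the entire sequence of localized blowups" and is the one
  used for sequences on p. 781; nor the last clause of Lemma 2 ("in the special case
  `ord H = pᵉ − p^{e−1}`, `d_curv < pᵉ`"), nor `d_𝓕 = 0` when `ord H = 0`.
* Lemmas 1, 3 and Propositions 3, 4 of [HP24] (existence of a maximising flag; the flag invariant
  `(d, n, s)` drops under every point blow-up at non-terminal equiconstant points) — hence NOT their
  corollary that for SURFACES the residual order never exceeds its running minimum by more than
  `p^{e−1}` along sequences of point blow-ups avoiding the terminal cases (Prop. 3 proof, p. 791: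
  "By Lemmas 1 and 2, the inequality `d_𝓕 ≤ d_res + p^{e−1}` holds for all flags"; Prop. 4, p. 793);
  the cell records that corollary as IN PRINT for two residual variables, in contrast with
  `Literature.Barriers.ResolutionOfSingularities.mohStabilityClaim_false` (`e ≥ 3`, four and more
  residual variables).
* More than two residual variables: §§1–6 hold for every `σ`; the quantitative §7 is stated for two
  letters only ([HP24]'s surfaces); in more variables the package "`m − 1` blow-ups at the origin of
  one chart" is not the general shape of the blow-ups between the creation and the loss of a
  component, and no printed statement exists ([HP24] §7 p. 798).
* Nothing here is a statement about resolution of singularities; census value only (row O5 of the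
  dimension-4 census of `pub-hironaka`).
-/

noncomputable section

open MvPolynomial Finset

open scoped BigOperators

namespace Literature.AlgebraicGeometry.Resolution

open Literature.AlgebraicGeometry.Resolution.Hauser2010
open Literature.Barriers.ResolutionOfSingularities
open Literature.AlgebraicGeometry.Resolution.WeightedBlowup

namespace PointBlowup

/-! ## 1. The package weight `w_m(d) = d_j + m·Σ_{k ≠ j} d_k` and the `m`-fold chart exponent -/

section Weights

variable {σ : Type*} [Fintype σ] [DecidableEq σ]

/-- The **package weight** of an exponent: `w_m(d) = d_j + m·Σ_{k≠j} d_k`, i.e. the weighted degree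
for the weights `ω(y_j) = 1`, `ω(y_k) = m` (`k ≠ j`) which monomialise `m` successive point blow-ups
read in the `y_j`-chart ("Introduce weights `ω(x) = 1` and `ω(ỹ) = n`").
[cite: HauserPerlega2024, §4 p. 781 (weights ω(x) = 1, ω(ỹ) = n)] -/
def pkgWeight (j : σ) (m : ℕ) (d : σ →₀ ℕ) : ℕ := d j + m * (d.degree - d j)

/-- The exponent of `y^d` after `m` point blow-ups in the `y_j`-chart (each followed by the division
by `y_j^q`): `y_j`-exponent `w_m(d) − m·q`, the other exponents unchanged (natural subtraction;
meaningful when `m·q ≤ w_m(d)`). [cite: HauserPerlega2024, §4 p. 781 (the first n − 1 blowups are x ↦ x, y ↦ xy)] -/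
def pkgExponent (q : ℕ) (j : σ) (m : ℕ) (d : σ →₀ ℕ) : σ →₀ ℕ :=
  d.update j (pkgWeight j m d - m * q)

omit [Fintype σ] [DecidableEq σ] in
/-- `w_0(d) = d_j`. [cite: HauserPerlega2024, §4 p. 781 (weighted order ω(x) = 1, ω(ỹ) = n)] -/
theorem pkgWeight_zero (j : σ) (d : σ →₀ ℕ) : pkgWeight j 0 d = d j := by
  simp [pkgWeight]

omit [Fintype σ] [DecidableEq σ] in
/-- `w_{m+1}(d) = w_m(d) + Σ_{k≠j} d_k`. [cite: HauserPerlega2024, §4 p. 781 (weighted order ω(x) = 1, ω(ỹ) = n)] -/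
theorem pkgWeight_succ (j : σ) (m : ℕ) (d : σ →₀ ℕ) :
    pkgWeight j (m + 1) d = pkgWeight j m d + (d.degree - d j) := by
  unfold pkgWeight; ring

omit [Fintype σ] [DecidableEq σ] in
/-- `w_1(d) = |d|`. [cite: HauserPerlega2024, §4 p. 781 (weighted order ω(x) = 1, ω(ỹ) = n)] -/
theorem pkgWeight_one (j : σ) (d : σ →₀ ℕ) : pkgWeight j 1 d = d.degree := by
  have := Finsupp.le_degree j d
  unfold pkgWeight; omega

omit [Fintype σ] [DecidableEq σ] in
/-- `w_m` is monotone in `m`. [cite: HauserPerlega2024, §4 p. 781 (weighted order ω(x) = 1, ω(ỹ) = n)] -/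
theorem pkgWeight_le_succ (j : σ) (m : ℕ) (d : σ →₀ ℕ) :
    pkgWeight j m d ≤ pkgWeight j (m + 1) d := by
  rw [pkgWeight_succ]; exact Nat.le_add_right _ _

omit [Fintype σ] [DecidableEq σ] in
/-- `d_j ≤ w_m(d)`. [cite: HauserPerlega2024, §4 p. 781 (weighted order ω(x) = 1, ω(ỹ) = n)] -/
theorem apply_le_pkgWeight (j : σ) (m : ℕ) (d : σ →₀ ℕ) : d j ≤ pkgWeight j m d :=
  Nat.le_add_right _ _

/-- `w_m(d) = d_j + m·Σ_{k ≠ j} d_k` with the sum written out. [cite: HauserPerlega2024, §4 p. 781 (weighted order ω(x) = 1, ω(ỹ) = n)] -/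
theorem pkgWeight_eq_add_mul_sum (j : σ) (m : ℕ) (d : σ →₀ ℕ) :
    pkgWeight j m d = d j + m * ∑ k ∈ univ.erase j, d k := by
  have h := degree_eq_add_sum_erase j d
  unfold pkgWeight
  congr 2
  omega

omit [Fintype σ] in
/-- The `m`-fold chart exponent, pointwise. [cite: HauserPerlega2024, §4 p. 781 (the first n − 1 blowups x ↦ x, y ↦ xy monomialized)] -/
theorem pkgExponent_apply (q : ℕ) (j : σ) (m : ℕ) (d : σ →₀ ℕ) (k : σ) :
    pkgExponent q j m d k = if k = j then pkgWeight j m d - m * q else d k := by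
  unfold pkgExponent
  rw [Finsupp.update_apply]

omit [Fintype σ] in
/-- No blow-up: the exponent is unchanged. [cite: HauserPerlega2024, §4 p. 781 (the first n − 1 blowups x ↦ x, y ↦ xy monomialized)] -/
theorem pkgExponent_zero (q : ℕ) (j : σ) (d : σ →₀ ℕ) : pkgExponent q j 0 d = d := by
  ext k
  rw [pkgExponent_apply]
  split_ifs with h
  · subst h; simp [pkgWeight_zero]
  · rfl

/-- The degree of the `m`-fold chart exponent: `|d^{(m)}| + m·q = w_{m+1}(d)`. [cite: HauserPerlega2024, §4 p. 781 (the first n − 1 blowups x ↦ x, y ↦ xy monomialized)] -/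
theorem degree_pkgExponent_add {q : ℕ} {j : σ} {m : ℕ} {d : σ →₀ ℕ}
    (h : m * q ≤ pkgWeight j m d) :
    (pkgExponent q j m d).degree + m * q = pkgWeight j (m + 1) d := by
  have h1 := degree_update_add d j (pkgWeight j m d - m * q)
  unfold pkgExponent
  rw [pkgWeight_succ]
  have h2 := apply_le_pkgWeight j m d
  have h3 := Finsupp.le_degree j d
  omega

/-- One more blow-up in the `y_j`-chart: `(d^{(m)})^ = d^{(m+1)}`. [cite: HauserPerlega2024, §4 p. 781 (the first n − 1 blowups x ↦ x, y ↦ xy monomialized)] -/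
theorem chartExponent_pkgExponent {q : ℕ} {j : σ} {m : ℕ} {d : σ →₀ ℕ}
    (h : m * q ≤ pkgWeight j m d) :
    chartExponent q j (pkgExponent q j m d) = pkgExponent q j (m + 1) d := by
  ext k
  rw [chartExponent_apply, pkgExponent_apply, pkgExponent_apply]
  split_ifs with hk
  · have h1 := degree_pkgExponent_add (q := q) h
    rw [Nat.succ_mul]
    omega
  · rfl

/-- The `m`-fold chart exponent determines the exponent (when no truncation occurs). [cite: HauserPerlega2024, §4 p. 781 (the first n − 1 blowups x ↦ x, y ↦ xy monomialized)] -/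
theorem pkgExponent_injective {q : ℕ} {j : σ} {m : ℕ} {d d' : σ →₀ ℕ}
    (hd : m * q ≤ pkgWeight j m d) (hd' : m * q ≤ pkgWeight j m d')
    (h : pkgExponent q j m d = pkgExponent q j m d') : d = d' := by
  have hne : ∀ k, k ≠ j → d k = d' k := fun k hk => by
    have := DFunLike.congr_fun h k
    rwa [pkgExponent_apply, pkgExponent_apply, if_neg hk, if_neg hk] at this
  have hj : pkgWeight j m d - m * q = pkgWeight j m d' - m * q := by
    have := DFunLike.congr_fun h j
    rwa [pkgExponent_apply, pkgExponent_apply, if_pos rfl, if_pos rfl] at this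
  have hsum : ∑ k ∈ univ.erase j, d k = ∑ k ∈ univ.erase j, d' k :=
    Finset.sum_congr rfl fun k hk => hne k (Finset.ne_of_mem_erase hk)
  have hw : pkgWeight j m d = pkgWeight j m d' := by omega
  rw [pkgWeight_eq_add_mul_sum, pkgWeight_eq_add_mul_sum, hsum] at hw
  ext k
  by_cases hk : k = j
  · subst hk; omega
  · exact hne k hk

/-- The `m`-fold chart exponent of a non-`q`-th-power exponent is not a `q`-th power exponent
(no truncation assumed): the point blow-ups at the origin of the `y_j`-chart preserve cleanness.
[cite: HauserPerlega2024, §6 p. 793 (if t = 0 the expansion of F′ is again clean)] -/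
theorem not_isPthPowerExponent_pkgExponent {q : ℕ} {j : σ} {m : ℕ} {d : σ →₀ ℕ}
    (hd : ¬ IsPthPowerExponent q d) (h : m * q ≤ pkgWeight j m d) :
    ¬ IsPthPowerExponent q (pkgExponent q j m d) := by
  intro hP
  rw [isPthPowerExponent_iff] at hP
  apply hd
  rw [isPthPowerExponent_iff]
  have hk : ∀ k, k ≠ j → q ∣ d k := fun k hk => by
    have := hP k
    rwa [pkgExponent_apply, if_neg hk] at this
  have hj := hP j
  rw [pkgExponent_apply, if_pos rfl] at hj
  have hsum : q ∣ ∑ k ∈ univ.erase j, d k :=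
    Finset.dvd_sum fun k hk' => hk k (Finset.ne_of_mem_erase hk')
  have hw : q ∣ pkgWeight j m d := by
    have h1 : q ∣ pkgWeight j m d - m * q + m * q := dvd_add hj (dvd_mul_left q m)
    rwa [Nat.sub_add_cancel h] at h1
  rw [pkgWeight_eq_add_mul_sum] at hw
  have hdj : q ∣ d j := (Nat.dvd_add_left (dvd_mul_of_dvd_right hsum m)).mp hw
  intro k
  by_cases hkj : k = j
  · subst hkj; exact hdj
  · exact hk k hkj

end Weights

/-! ## 2. The package transform `F ↦ Σ_d [y^d]F · y^{d^{(m)}}` -/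

section Transform

variable {σ : Type*} {K : Type*} [Field K] [Fintype σ] [DecidableEq σ]

/-- The **package transform**: the residual polynomial after `m` point blow-ups at the origin of the
`y_j`-chart, `F^{(m)} = Σ_d [y^d]F · y^{d^{(m)}}` (before any translation or cleaning).
[cite: HauserPerlega2024, §4 p. 781 (the first n − 1 blowups … the last blowup)] -/
def pkgTransform (q : ℕ) (j : σ) (m : ℕ) (F : MvPolynomial σ K) : MvPolynomial σ K :=
  ∑ d ∈ F.support, monomial (pkgExponent q j m d) (coeff d F)

omit [Fintype σ] in
/-- No blow-up: `F^{(0)} = F`. [cite: HauserPerlega2024, §4 p. 781 (the first n − 1 blowups x ↦ x, y ↦ xy monomialized)] -/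
theorem pkgTransform_zero (q : ℕ) (j : σ) (F : MvPolynomial σ K) : pkgTransform q j 0 F = F := by
  unfold pkgTransform
  conv_rhs => rw [F.as_sum]
  exact Finset.sum_congr rfl fun d _ => by rw [pkgExponent_zero]

omit [Fintype σ] in
/-- The monomials of the package transform come from monomials of `F`. [cite: HauserPerlega2024, §4 p. 781 (the first n − 1 blowups x ↦ x, y ↦ xy monomialized)] -/
theorem exists_of_mem_support_pkgTransform {q : ℕ} {j : σ} {m : ℕ} {F : MvPolynomial σ K}
    {E : σ →₀ ℕ} (hE : E ∈ (pkgTransform q j m F).support) :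
    ∃ d ∈ F.support, pkgExponent q j m d = E := by
  obtain ⟨d, hd, -, hdE⟩ := exists_of_mem_support_sum_monomial _ _ _ hE
  exact ⟨d, hd, hdE⟩

/-- The coefficients of the package transform (no truncation). [cite: HauserPerlega2024, §4 p. 781 (the first n − 1 blowups x ↦ x, y ↦ xy monomialized)] -/
theorem coeff_pkgTransform {q : ℕ} {j : σ} {m : ℕ} {F : MvPolynomial σ K}
    (hF : ∀ d ∈ F.support, m * q ≤ pkgWeight j m d) {d : σ →₀ ℕ} (hd : d ∈ F.support) :
    coeff (pkgExponent q j m d) (pkgTransform q j m F) = coeff d F := by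
  unfold pkgTransform
  refine coeff_sum_monomial_of_injOn F.support (pkgExponent q j m) (fun d => coeff d F) hd ?_
  intro d' hd' _ h
  exact pkgExponent_injective (hF d' hd') (hF d hd) h

/-- The support of the package transform (no truncation). [cite: HauserPerlega2024, §4 p. 781 (the first n − 1 blowups x ↦ x, y ↦ xy monomialized)] -/
theorem support_pkgTransform {q : ℕ} {j : σ} {m : ℕ} {F : MvPolynomial σ K}
    (hF : ∀ d ∈ F.support, m * q ≤ pkgWeight j m d) :
    (pkgTransform q j m F).support = F.support.image (pkgExponent q j m) := by
  ext E
  rw [Finset.mem_image]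
  constructor
  · intro hE
    exact exists_of_mem_support_pkgTransform hE
  · rintro ⟨d, hd, rfl⟩
    rw [MvPolynomial.mem_support_iff, coeff_pkgTransform hF hd]
    exact MvPolynomial.mem_support_iff.mp hd

/-- **One more blow-up at the origin of the `y_j`-chart**: `(F^{(m)})' = F^{(m+1)}` (no truncation).
[cite: HauserPerlega2024, §4 p. 781 (the first n − 1 blowups are given by x ↦ x, y ↦ xy)] -/
theorem chartTransform_pkgTransform {q : ℕ} {j : σ} {m : ℕ} {F : MvPolynomial σ K}
    (hF : ∀ d ∈ F.support, m * q ≤ pkgWeight j m d) :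
    chartTransform q j (pkgTransform q j m F) = pkgTransform q j (m + 1) F := by
  unfold chartTransform
  rw [support_pkgTransform hF, Finset.sum_image]
  · rw [show pkgTransform q j (m + 1) F =
        ∑ d ∈ F.support, monomial (pkgExponent q j (m + 1) d) (coeff d F) from rfl]
    refine Finset.sum_congr rfl fun d hd => ?_
    rw [coeff_pkgTransform hF hd, chartExponent_pkgExponent (hF d hd)]
  · intro d hd d' hd' h
    exact pkgExponent_injective (hF d hd) (hF d' hd') h

/-- The package transform of a CLEAN polynomial is clean (no truncation). [cite: HauserPerlega2024, §6 p. 793 (if t = 0 the expansion of F′ is again clean)] -/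
theorem deletePthPowers_pkgTransform {q : ℕ} {j : σ} {m : ℕ} {F : MvPolynomial σ K}
    (hclean : deletePthPowers q F = F) (hF : ∀ d ∈ F.support, m * q ≤ pkgWeight j m d) :
    deletePthPowers q (pkgTransform q j m F) = pkgTransform q j m F := by
  ext E
  rw [coeff_deletePthPowers]
  split_ifs with hP
  · by_contra hne
    obtain ⟨d, hd, rfl⟩ :=
      exists_of_mem_support_pkgTransform (MvPolynomial.mem_support_iff.mpr (Ne.symm hne))
    exact not_isPthPowerExponent_pkgExponent (not_isPthPowerExponent_of_clean q hclean hd)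
      (hF d hd) hP
  · rfl

/-- Degrees in the package transform: `q ≤ ord₀ F^{(m)}` gives `(m+1)·q ≤ w_{m+1}(d)` on the
support of `F` (no truncation at the next blow-up). [cite: HauserPerlega2024, §4 p. 781 (the first n − 1 blowups x ↦ x, y ↦ xy monomialized)] -/
theorem succ_mul_le_pkgWeight_of_le_ordZero {q : ℕ} {j : σ} {m : ℕ} {F : MvPolynomial σ K}
    (hF : ∀ d ∈ F.support, m * q ≤ pkgWeight j m d)
    (hord : (q : ℕ∞) ≤ ordZero (pkgTransform q j m F)) :
    ∀ d ∈ F.support, (m + 1) * q ≤ pkgWeight j (m + 1) d := by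
  intro d hd
  have hmem : pkgExponent q j m d ∈ (pkgTransform q j m F).support := by
    rw [MvPolynomial.mem_support_iff, coeff_pkgTransform hF hd]
    exact MvPolynomial.mem_support_iff.mp hd
  have h1 : (q : ℕ∞) ≤ ((pkgExponent q j m d).degree : ℕ∞) :=
    le_trans hord (ordZero_le_of_coeff_ne_zero _ _ (MvPolynomial.mem_support_iff.mp hmem))
  have h2 : q ≤ (pkgExponent q j m d).degree := by exact_mod_cast h1
  have h3 := degree_pkgExponent_add (hF d hd)
  rw [Nat.succ_mul]
  omega

end Transform

/-! ## 3. The least package weight `w₀` and the order of the package transform -/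

section MinWeight

variable {σ : Type*} {K : Type*} [Field K] [Fintype σ] [DecidableEq σ]

/-- The **least package weight** `w₀ = min_{d ∈ supp F} w_m(d)` of a polynomial — its weighted
order `ord_ω(F)` for `ω(y_j) = 1`, `ω(y_k) = m` (`0` for `F = 0`).
[cite: HauserPerlega2024, §4 p. 781 (weighted order ω(g))] -/
def minPkgWeight (j : σ) (m : ℕ) (F : MvPolynomial σ K) : ℕ :=
  sInf (pkgWeight j m '' (F.support : Set (σ →₀ ℕ)))

omit [Fintype σ] [DecidableEq σ] in
/-- Every monomial has weight `≥ w₀`. [cite: HauserPerlega2024, §4 p. 781 (weighted order ω(x) = 1, ω(ỹ) = n)] -/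
theorem minPkgWeight_le (j : σ) (m : ℕ) {F : MvPolynomial σ K} {d : σ →₀ ℕ}
    (hd : d ∈ F.support) : minPkgWeight j m F ≤ pkgWeight j m d :=
  Nat.sInf_le ⟨d, hd, rfl⟩

omit [Fintype σ] [DecidableEq σ] in
/-- The least weight is attained. [cite: HauserPerlega2024, §4 p. 781 (weighted order ω(x) = 1, ω(ỹ) = n)] -/
theorem exists_pkgWeight_eq_minPkgWeight (j : σ) (m : ℕ) {F : MvPolynomial σ K} (hF : F ≠ 0) :
    ∃ d ∈ F.support, pkgWeight j m d = minPkgWeight j m F := by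
  obtain ⟨d₀, hd₀⟩ := MvPolynomial.ne_zero_iff.mp hF
  have hne : (pkgWeight j m '' (F.support : Set (σ →₀ ℕ))).Nonempty :=
    ⟨pkgWeight j m d₀, d₀, MvPolynomial.mem_support_iff.mpr hd₀, rfl⟩
  obtain ⟨d, hd, hdw⟩ := Nat.sInf_mem hne
  exact ⟨d, hd, hdw⟩

omit [Fintype σ] [DecidableEq σ] in
/-- The least weight is monotone in `m`. [cite: HauserPerlega2024, §4 p. 781 (weighted order ω(x) = 1, ω(ỹ) = n)] -/
theorem minPkgWeight_le_succ (j : σ) (m : ℕ) {F : MvPolynomial σ K} (hF : F ≠ 0) :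
    minPkgWeight j m F ≤ minPkgWeight j (m + 1) F := by
  obtain ⟨d, hd, hdw⟩ := exists_pkgWeight_eq_minPkgWeight j (m + 1) hF
  rw [← hdw]
  exact le_trans (minPkgWeight_le j m hd) (pkgWeight_le_succ j m d)

/-- **The order of the package transform**: `ord₀ F^{(m)} = w₀^{(m+1)} − m·q`, where `w₀^{(m+1)}` is
the least `(m+1)`-weight (no truncation). [cite: HauserPerlega2024, §4 p. 781 (ord_ω)] -/
theorem ordZero_pkgTransform {q : ℕ} {j : σ} {m : ℕ} {F : MvPolynomial σ K} (hF0 : F ≠ 0)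
    (hF : ∀ d ∈ F.support, m * q ≤ pkgWeight j m d) :
    ordZero (pkgTransform q j m F) = ((minPkgWeight j (m + 1) F - m * q : ℕ) : ℕ∞) := by
  rw [ordZero_eq_nat_iff]
  obtain ⟨d₁, hd₁, hd₁w⟩ := exists_pkgWeight_eq_minPkgWeight j (m + 1) hF0
  refine ⟨⟨pkgExponent q j m d₁, ?_, ?_⟩, ?_⟩
  · rw [coeff_pkgTransform hF hd₁]; exact MvPolynomial.mem_support_iff.mp hd₁
  · have h := degree_pkgExponent_add (hF d₁ hd₁)
    omega
  · intro E hE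
    by_contra hne
    obtain ⟨d, hd, rfl⟩ :=
      exists_of_mem_support_pkgTransform (MvPolynomial.mem_support_iff.mpr hne)
    have h1 := degree_pkgExponent_add (hF d hd)
    have h2 := minPkgWeight_le j (m + 1) hd
    omega

end MinWeight

/-! ## 4. The package along a sequence of states: `m − 1` blow-ups at the origin of the
## `y_j`-chart, then one at the point `b` of the `y_j`-chart -/

section Package

variable {σ : Type*} {K : Type*} [Field K] [Fintype σ] [DecidableEq σ] [DecidableEq K]

/-- One blow-up at the ORIGIN of the `y_j`-chart of a clean state in package form:
`(F^{(m)})' = F^{(m+1)}` — no translation, and the cleaning deletes nothing. [cite: HauserPerlega2024, §4 p. 781 (the first n − 1 blowups x ↦ x, y ↦ xy monomialized)] -/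
theorem step_origin_F {q : ℕ} (j : σ) (s : State σ K) {m : ℕ} {F : MvPolynomial σ K}
    (hsF : s.F = pkgTransform q j m F) (hclean : deletePthPowers q F = F)
    (hF : ∀ d ∈ F.support, m * q ≤ pkgWeight j m d)
    (hF' : ∀ d ∈ F.support, (m + 1) * q ≤ pkgWeight j (m + 1) d) :
    (step q j 0 s).F = pkgTransform q j (m + 1) F := by
  change deletePthPowers q (translate 0 (chartTransform q j s.F)) = _
  rw [translate_zero, hsF, chartTransform_pkgTransform hF, deletePthPowers_pkgTransform hclean hF']

omit [Fintype σ] in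
/-- A blow-up at the origin keeps every old multiplicity except the `j`-th. [cite: HauserPerlega2024, §4 p. 779 (E′ = V(xy) if t = 0)] -/
theorem step_origin_r_apply {q : ℕ} (j : σ) (s : State σ K) {k : σ} (hk : k ≠ j) :
    (step q j 0 s).r k = s.r k := by
  change newMult q j 0 s k = s.r k
  unfold newMult
  rw [Finsupp.update_apply, if_neg hk, Finsupp.filter_apply, if_pos (show (0 : σ → K) k = 0 from rfl)]

/-- **The package prefix**: after `n < m` blow-ups at the origin of the `y_j`-chart, the residual
polynomial is `F^{(n)}`, no truncation has occurred up to level `n + 1`, and the multiplicities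
other than the `j`-th are the initial ones. [cite: HauserPerlega2024, §4 p. 781 (the first n − 1 blowups)] -/
theorem package_prefix (q : ℕ) (j : σ) (m : ℕ) (s : ℕ → State σ K)
    (hstep : ∀ n, n + 1 < m → s (n + 1) = step q j 0 (s n))
    (hclean : deletePthPowers q (s 0).F = (s 0).F)
    (hord : ∀ n, n < m → (q : ℕ∞) ≤ ordZero (s n).F) :
    ∀ n, n < m → (s n).F = pkgTransform q j n (s 0).F ∧
      (∀ d ∈ (s 0).F.support, n * q ≤ pkgWeight j n d) ∧
      (∀ d ∈ (s 0).F.support, (n + 1) * q ≤ pkgWeight j (n + 1) d) ∧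
      (∀ k, k ≠ j → (s n).r k = (s 0).r k) := by
  intro n
  induction n with
  | zero =>
    intro h0
    have h1 : ∀ d ∈ (s 0).F.support, 0 * q ≤ pkgWeight j 0 d := fun d _ => by simp
    refine ⟨(pkgTransform_zero q j _).symm, h1, ?_, fun k _ => rfl⟩
    refine succ_mul_le_pkgWeight_of_le_ordZero h1 ?_
    rw [pkgTransform_zero]; exact hord 0 h0
  | succ n ih =>
    intro hn
    obtain ⟨hF, hle, hle', hr⟩ := ih (by omega)
    have hF' : (s (n + 1)).F = pkgTransform q j (n + 1) (s 0).F := by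
      rw [hstep n hn]; exact step_origin_F j (s n) hF hclean hle hle'
    refine ⟨hF', hle', ?_, fun k hk => ?_⟩
    · refine succ_mul_le_pkgWeight_of_le_ordZero hle' ?_
      rw [← hF']; exact hord (n + 1) hn
    · rw [hstep n hn, step_origin_r_apply j (s n) hk, hr k hk]

/-- The degree of a filtered update at an index inside the filter. [folklore] -/
private theorem degree_filter_update (f : σ →₀ ℕ) {Z : σ → Prop} [DecidablePred Z] {j : σ} (hj : Z j)
    (v : ℕ) : ((f.update j v).filter Z).degree = v + ∑ k ∈ (univ.erase j).filter Z, f k := by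
  rw [Finsupp.degree_eq_sum, ← Finset.add_sum_erase _ _ (Finset.mem_univ j), Finset.sum_filter]
  congr 1
  · rw [Finsupp.filter_apply, if_pos hj, Finsupp.update_apply, if_pos rfl]
  · refine Finset.sum_congr rfl fun k hk => ?_
    rw [Finsupp.filter_apply, Finsupp.update_apply, if_neg (Finset.ne_of_mem_erase hk)]

/-- **The package, closed form.** After `m − 1` blow-ups at the origin of the `y_j`-chart and one
at the point `b` of the `y_j`-chart (order `≥ q` throughout, clean start `F ≠ 0`): the residual
polynomial is the cleaning of `translate b (F^{(m)})`, no truncation occurs (`m·q ≤ w_m(d)` on the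
support), and the exceptional monomial has degree `|r'| = (w₀ − m·q) + Σ_{k ≠ j, b_k = 0} r_k`,
`w₀` the least `m`-weight ("This change of parameters monomializes the entire sequence of localized
blowups"). [cite: HauserPerlega2024, §4 p. 781 (ỹ = y + t xⁿ monomializes the sequence)] -/
theorem package_closed_form (q : ℕ) (j : σ) {m : ℕ} (hm : 1 ≤ m) (s : ℕ → State σ K)
    (b : σ → K) (hbj : b j = 0)
    (hstep : ∀ n, n + 1 < m → s (n + 1) = step q j 0 (s n))
    (hlast : s m = step q j b (s (m - 1)))
    (hF0 : (s 0).F ≠ 0) (hclean : deletePthPowers q (s 0).F = (s 0).F)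
    (hord : ∀ n, n < m → (q : ℕ∞) ≤ ordZero (s n).F) :
    (s m).F = deletePthPowers q (translate b (pkgTransform q j m (s 0).F)) ∧
      (∀ d ∈ (s 0).F.support, m * q ≤ pkgWeight j m d) ∧
      m * q ≤ minPkgWeight j m (s 0).F ∧
      (s m).r.degree = (minPkgWeight j m (s 0).F - m * q) +
        ∑ k ∈ (univ.erase j).filter (fun k : σ => b k = 0), (s 0).r k := by
  obtain ⟨hF, hle, hle', hr⟩ := package_prefix q j m s hstep hclean hord (m - 1) (by omega)
  have hm1 : m - 1 + 1 = m := by omega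
  rw [hm1] at hle'
  have hordm : ordZero (s (m - 1)).F = ((minPkgWeight j m (s 0).F - (m - 1) * q : ℕ) : ℕ∞) := by
    rw [hF, ordZero_pkgTransform hF0 hle, hm1]
  obtain ⟨d₁, hd₁, hd₁w⟩ := exists_pkgWeight_eq_minPkgWeight j m hF0
  have hmq : m * q ≤ minPkgWeight j m (s 0).F := by rw [← hd₁w]; exact hle' d₁ hd₁
  refine ⟨?_, hle', hmq, ?_⟩
  · rw [hlast]
    change deletePthPowers q (translate b (chartTransform q j (s (m - 1)).F)) = _
    rw [hF, chartTransform_pkgTransform hle, hm1]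
  · rw [hlast]
    change (newMult q j b (s (m - 1))).degree = _
    rw [newMult_eq q j b hbj (s (m - 1)) hordm,
      degree_filter_update (Z := fun k : σ => b k = 0) _ hbj]
    have hsum : ∑ k ∈ (univ.erase j).filter (fun k : σ => b k = 0), (s (m - 1)).r k =
        ∑ k ∈ (univ.erase j).filter (fun k : σ => b k = 0), (s 0).r k :=
      Finset.sum_congr rfl fun k hk => hr k (Finset.ne_of_mem_erase (Finset.mem_filter.mp hk).1)
    rw [hsum]
    have : (m - 1) * q + q = m * q := by
      rw [show m * q = (m - 1 + 1) * q by rw [hm1], Nat.succ_mul]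
    omega

end Package

/-! ## 5. The weighted initial form `In_ω F` and the lowest `y_j`-layer of the package -/

section Initial

variable {σ : Type*} {K : Type*} [Field K] [Fintype σ] [DecidableEq σ]

/-- The **weighted initial form** `In_ω(F)`: the part of `F` of least package weight `w₀`
("the weighted initial form of `g` with respect to `ω` is defined as
`in_ω(g) = Σ_{ω(x^i y^j) = ω(g)} c_{ij} x^i y^j`"). [cite: HauserPerlega2024, §4 p. 781 (in_ω(g))] -/
def pkgInitial (j : σ) (m : ℕ) (F : MvPolynomial σ K) : MvPolynomial σ K :=
  ∑ d ∈ F.support with pkgWeight j m d = minPkgWeight j m F, monomial d (coeff d F)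

omit [Fintype σ] in
/-- Coefficients of the weighted initial form. [cite: HauserPerlega2024, §4 p. 781 (weighted initial form in_ω)] -/
theorem coeff_pkgInitial (j : σ) (m : ℕ) (F : MvPolynomial σ K) (d : σ →₀ ℕ) :
    coeff d (pkgInitial j m F) =
      if pkgWeight j m d = minPkgWeight j m F then coeff d F else 0 := by
  classical
  simp only [pkgInitial, coeff_sum, coeff_monomial]
  rw [Finset.sum_ite_eq']
  by_cases h : pkgWeight j m d = minPkgWeight j m F
  · by_cases hd : d ∈ F.support
    · simp [h, hd]
    · have : coeff d F = 0 := by simpa [MvPolynomial.mem_support_iff] using hd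
      simp [h, this]
  · simp [h]

omit [Fintype σ] in
/-- The support of the weighted initial form: the monomials of `F` of least weight. [cite: HauserPerlega2024, §4 p. 781 (weighted initial form in_ω)] -/
theorem mem_support_pkgInitial {j : σ} {m : ℕ} {F : MvPolynomial σ K} {d : σ →₀ ℕ} :
    d ∈ (pkgInitial j m F).support ↔ d ∈ F.support ∧ pkgWeight j m d = minPkgWeight j m F := by
  rw [MvPolynomial.mem_support_iff, MvPolynomial.mem_support_iff, coeff_pkgInitial]
  constructor
  · intro h
    by_cases hw : pkgWeight j m d = minPkgWeight j m F
    · rw [if_pos hw] at h; exact ⟨h, hw⟩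
    · rw [if_neg hw] at h; exact (h rfl).elim
  · rintro ⟨h, hw⟩
    rw [if_pos hw]; exact h

omit [Fintype σ] in
/-- The support of the weighted initial form as a filter. [cite: HauserPerlega2024, §4 p. 781 (weighted initial form in_ω)] -/
theorem support_pkgInitial (j : σ) (m : ℕ) (F : MvPolynomial σ K) :
    (pkgInitial j m F).support = F.support.filter fun d => pkgWeight j m d = minPkgWeight j m F := by
  ext d
  rw [mem_support_pkgInitial, Finset.mem_filter]

omit [Fintype σ] in
/-- The weighted initial form of a non-zero polynomial is non-zero. [cite: HauserPerlega2024, §4 p. 781 (weighted initial form in_ω)] -/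
theorem pkgInitial_ne_zero (j : σ) (m : ℕ) {F : MvPolynomial σ K} (hF : F ≠ 0) :
    pkgInitial j m F ≠ 0 := by
  obtain ⟨d, hd, hdw⟩ := exists_pkgWeight_eq_minPkgWeight j m hF
  rw [MvPolynomial.ne_zero_iff]
  exact ⟨d, MvPolynomial.mem_support_iff.mp (mem_support_pkgInitial.mpr ⟨hd, hdw⟩)⟩

omit [Fintype σ] in
/-- The weighted initial form of a clean polynomial is clean. [cite: HauserPerlega2024, §4 p. 781 (weighted initial form in_ω)] -/
theorem not_isPthPowerExponent_of_mem_support_pkgInitial (q : ℕ) {j : σ} {m : ℕ}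
    {F : MvPolynomial σ K} (hclean : deletePthPowers q F = F) {d : σ →₀ ℕ}
    (hd : d ∈ (pkgInitial j m F).support) : ¬ IsPthPowerExponent q d :=
  not_isPthPowerExponent_of_clean q hclean (mem_support_pkgInitial.mp hd).1

omit [Fintype σ] in
/-- The package transform of `F` splits as that of `In_ω F` plus that of the rest. [cite: HauserPerlega2024, §4 p. 781 (weighted initial form in_ω)] -/
theorem pkgTransform_eq_add (q : ℕ) (j : σ) (m : ℕ) (F : MvPolynomial σ K) :
    pkgTransform q j m F = pkgTransform q j m (pkgInitial j m F) +
      ∑ d ∈ F.support with ¬ pkgWeight j m d = minPkgWeight j m F,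
        monomial (pkgExponent q j m d) (coeff d F) := by
  unfold pkgTransform
  rw [support_pkgInitial, ← Finset.sum_filter_add_sum_filter_not F.support
    (fun d => pkgWeight j m d = minPkgWeight j m F)]
  congr 1
  refine Finset.sum_congr rfl fun d hd => ?_
  rw [coeff_pkgInitial, if_pos (Finset.mem_filter.mp hd).2]

/-- **The lowest `y_j`-layer of the package is the package of the weighted initial form**: on
exponents with `E_j = w₀ − m·q` the translated package transforms of `F` and of `In_ω F` have the
same coefficients ("let `in_ω(F̃)` be the weighted initial form … `d̃` the order of `in_ω(F̃)` along
the curve … bounds the residual order of the final strict transform"). [cite: HauserPerlega2024, §4 p. 781] -/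
theorem coeff_translate_pkgTransform_layer (q : ℕ) (j : σ) (b : σ → K) (hbj : b j = 0) (m : ℕ)
    {F : MvPolynomial σ K} (hF : ∀ d ∈ F.support, m * q ≤ pkgWeight j m d) {E : σ →₀ ℕ}
    (hE : E j = minPkgWeight j m F - m * q) :
    coeff E (translate b (pkgTransform q j m F)) =
      coeff E (translate b (pkgTransform q j m (pkgInitial j m F))) := by
  rw [pkgTransform_eq_add]
  unfold translate
  rw [map_add, coeff_add, map_sum, coeff_sum]
  have hzero : ∀ d ∈ F.support.filter (fun d => ¬ pkgWeight j m d = minPkgWeight j m F),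
      coeff E (aeval (fun i => (X i + C (b i) : MvPolynomial σ K))
        (monomial (pkgExponent q j m d) (coeff d F))) = 0 := by
    intro d hd
    obtain ⟨hdF, hdw⟩ := Finset.mem_filter.mp hd
    have h1 := minPkgWeight_le j m hdF
    have h2 := hF d hdF
    obtain ⟨d₁, hd₁, hd₁w⟩ := exists_pkgWeight_eq_minPkgWeight j m
      (MvPolynomial.ne_zero_iff.mpr ⟨d, MvPolynomial.mem_support_iff.mp hdF⟩)
    have h3 : m * q ≤ minPkgWeight j m F := by rw [← hd₁w]; exact hF d₁ hd₁
    have hlt : E j < pkgExponent q j m d j := by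
      rw [hE, pkgExponent_apply, if_pos rfl]
      omega
    exact coeff_translate_monomial_eq_zero_of_apply_eq_zero b _ E _ hbj hlt
  rw [Finset.sum_eq_zero hzero, add_zero]

/-- Every monomial of the translated package transform lies on or above the lowest layer
`E_j = w₀ − m·q`. [cite: HauserPerlega2024, §4 p. 781 (d̃ bounds the residual order at the end of the sequence)] -/
theorem le_apply_of_mem_support_translate_pkgTransform (q : ℕ) (j : σ) (b : σ → K)
    (hbj : b j = 0) (m : ℕ) (F : MvPolynomial σ K) {E : σ →₀ ℕ}
    (hE : E ∈ (translate b (pkgTransform q j m F)).support) :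
    minPkgWeight j m F - m * q ≤ E j := by
  rw [MvPolynomial.mem_support_iff] at hE
  unfold translate pkgTransform at hE
  rw [map_sum, coeff_sum] at hE
  obtain ⟨d, hd, hne⟩ := Finset.exists_ne_zero_of_sum_ne_zero hE
  have h1 : E j = pkgExponent q j m d j := apply_eq_of_coeff_translate_monomial_ne_zero b hbj hne
  rw [h1, pkgExponent_apply, if_pos rfl]
  exact Nat.sub_le_sub_right (minPkgWeight_le j m hd) _

end Initial

/-! ## 6. The Hasse probe across the package (Hauser–Perlega's `∂_{y^{p^k}}` on `in_ω`) -/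

section Probe

variable {σ : Type*} {K : Type*} [Field K] [Fintype σ] [DecidableEq σ] [DecidableEq K]
variable (p : ℕ) [hp : Fact p.Prime] [CharP K p]

/-- **The Hasse probe across the package.** Let `P` be weighted-homogeneous of weight `w`
(`w_m(d) = w` on its support; e.g. `P = In_ω F`), `q = pᵉ`, `m·q ≤ w`, `b` a point of the `y_j`-chart
(`b_j = 0`), `i ≠ j`, `k < e`, and suppose some monomial `y^{d₀}` of `P` has
`((d₀)_i choose p^k) ≢ 0 (mod p)`. Then — since `D^{(p^k·e_i)}` commutes with the translation, acts
diagonally on the package transform, and kills `q`-th powers — the CLEANED translated package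
transform `clean(translate b (P^{(m)}))` has a monomial `y^E` in the layer `E_j = w − m·q` with
`q ∤ E_i` and `|E| ≤ |ρ restricted to {b = 0}| + D + p^k`, for every `ρ`, `D` with
`ρ + p^k·e_i ≤ d^{(m)}` and `|d^{(m)}| ≤ |ρ| + p^k + D` on the probe monomials (the layer lemma of
the tree). This is the mechanism of [HP24, Lemma 2] ("`∂_{y^{p^k}}(in_ω(F))` does not vanish …
`d_curv ≤ ord_{(y₁)} ∂_{y₁^{p^k}}(in_{ω₁}(F₁)) + p^k`") in fixed coordinates.
[cite: HauserPerlega2024, Lemma 2 p. 789–790 (proof)] [cite: Moh1987, §1 Propositions 1–2] -/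
theorem exists_support_package_of_choose_ne_zero {e : ℕ} (j : σ) (b : σ → K) (hbj : b j = 0)
    (m : ℕ) (P : MvPolynomial σ K) {w : ℕ} (hw : ∀ d ∈ P.support, pkgWeight j m d = w)
    (hmq : m * p ^ e ≤ w) {i : σ} (hij : i ≠ j) {k : ℕ} (hk : k < e)
    {d₀ : σ →₀ ℕ} (hd₀ : d₀ ∈ P.support) (hd₀i : ((d₀ i).choose (p ^ k) : K) ≠ 0)
    (ρ : σ →₀ ℕ) (hρj : ρ j = w - m * p ^ e)
    (hρ : ∀ d ∈ P.support, ((d i).choose (p ^ k) : K) ≠ 0 →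
      ρ + Finsupp.single i (p ^ k) ≤ pkgExponent (p ^ e) j m d)
    (D : ℕ) (hD : ∀ d ∈ P.support, ((d i).choose (p ^ k) : K) ≠ 0 →
      (pkgExponent (p ^ e) j m d).degree ≤ ρ.degree + p ^ k + D) :
    ∃ E ∈ (deletePthPowers (p ^ e) (translate b (pkgTransform (p ^ e) j m P))).support,
      E j = w - m * p ^ e ∧ ¬ p ^ e ∣ E i ∧
      E.degree ≤ (ρ.filter (fun l => b l = 0)).degree + D + p ^ k := by
  set q : ℕ := p ^ e with hqdef
  set a : ℕ := p ^ k with hadef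
  have hPw : ∀ d ∈ P.support, m * q ≤ pkgWeight j m d := fun d hd => by rw [hw d hd]; exact hmq
  have hpei : ∀ d : σ →₀ ℕ, pkgExponent q j m d i = d i := fun d => by
    rw [pkgExponent_apply, if_neg hij]
  have hchoose_le : ∀ d : σ →₀ ℕ, ((d i).choose a : K) ≠ 0 → a ≤ d i := by
    intro d hd
    by_contra hlt
    exact hd (by rw [Nat.choose_eq_zero_of_lt (not_le.mp hlt), Nat.cast_zero])
  -- the probe polynomial
  set G : MvPolynomial σ K := translate b (pkgTransform q j m P) with hGdef
  set f : (σ →₀ ℕ) → (σ →₀ ℕ) := fun d => pkgExponent q j m d - Finsupp.single i a with hfdef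
  set g : (σ →₀ ℕ) → K := fun d => coeff d P * ((d i).choose a : K) with hgdef
  set Pt : MvPolynomial σ K := ∑ d ∈ P.support, monomial (f d) (g d) with hPt
  have hderiv : hasseDeriv K (Finsupp.single i a) G = translate b Pt := by
    rw [hGdef, hPt]
    unfold translate pkgTransform
    rw [map_sum, map_sum, map_sum]
    refine Finset.sum_congr rfl fun d _ => ?_
    have := hasseDeriv_translate b (Finsupp.single i a)
      (monomial (pkgExponent q j m d) (coeff d P))
    unfold translate at this
    rw [this, hasseDeriv_single_monomial, hpei]
  have hsuppPt : ∀ e' ∈ Pt.support, ∃ d ∈ P.support, g d ≠ 0 ∧ f d = e' := fun e' he =>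
    exists_of_mem_support_sum_monomial _ _ _ he
  have hgi : ∀ d, g d ≠ 0 → ((d i).choose a : K) ≠ 0 := fun d hgd h0 =>
    hgd (by rw [hgdef]; simp only [h0, mul_zero])
  have hsingle_le : ∀ d : σ →₀ ℕ, a ≤ d i → Finsupp.single i a ≤ pkgExponent q j m d := by
    intro d hd
    rw [Finsupp.single_le_iff, hpei]
    exact hd
  have hfj : ∀ d ∈ P.support, f d j = w - m * q := fun d hd => by
    rw [hfdef]
    simp only [Finsupp.tsub_apply, pkgExponent_apply, if_true, Finsupp.single_apply,
      if_neg hij, Nat.sub_zero, hw d hd]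
  have hfdeg : ∀ d : σ →₀ ℕ, a ≤ d i → (f d).degree + a = (pkgExponent q j m d).degree := by
    intro d hd
    have h1 : f d + Finsupp.single i a = pkgExponent q j m d := by
      rw [hfdef]; exact tsub_add_cancel_of_le (hsingle_le d hd)
    have h2 := congrArg Finsupp.degree h1
    rw [map_add, Finsupp.degree_single] at h2
    exact h2
  have hρle : ∀ e' ∈ Pt.support, ρ ≤ e' := by
    intro e' he
    obtain ⟨d, hd, hgd, rfl⟩ := hsuppPt e' he
    rw [hfdef]
    exact le_tsub_of_add_le_right (hρ d hd (hgi d hgd))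
  have hD' : ∀ e' ∈ Pt.support, e' j = ρ j → e'.degree ≤ ρ.degree + D := by
    intro e' he _
    obtain ⟨d, hd, hgd, rfl⟩ := hsuppPt e' he
    have h1 := hfdeg d (hchoose_le d (hgi d hgd))
    have h2 := hD d hd (hgi d hgd)
    omega
  have hgd₀ : g d₀ ≠ 0 := by
    rw [hgdef]
    exact mul_ne_zero (MvPolynomial.mem_support_iff.mp hd₀) hd₀i
  have hlayer : ∃ e' ∈ Pt.support, e' j = ρ j := by
    refine ⟨f d₀, ?_, ?_⟩
    · rw [MvPolynomial.mem_support_iff, hPt, coeff_sum_monomial_of_injOn P.support f g hd₀]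
      · exact hgd₀
      · intro d hd hgd h
        have h' : pkgExponent q j m d = pkgExponent q j m d₀ :=
          (tsub_left_inj (hsingle_le d (hchoose_le d (hgi d hgd)))
            (hsingle_le d₀ (hchoose_le d₀ hd₀i))).mp h
        exact pkgExponent_injective (hPw d hd) (hPw d₀ hd₀) h'
    · rw [hfj d₀ hd₀, hρj]
  obtain ⟨E', hE', hE'j, hE'deg⟩ :=
    exists_mem_support_translate_layer b hbj Pt ρ hρle D hD' hlayer
  -- `E' + a·e_i` is a monomial of `G` surviving the cleaning
  rw [← hderiv, MvPolynomial.mem_support_iff, coeff_hasseDeriv_single] at hE'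
  have hcoeff : coeff (E' + Finsupp.single i a) G ≠ 0 := fun h => hE' (by rw [h, mul_zero])
  have hcast : (((E' i + a).choose a : ℕ) : K) ≠ 0 := fun h => hE' (by rw [h, zero_mul])
  set E : σ →₀ ℕ := E' + Finsupp.single i a with hEdef
  have hEi : E i = E' i + a := by
    rw [hEdef, Finsupp.add_apply, Finsupp.single_eq_same]
  have hnoti : ¬ q ∣ E i := by
    intro h1
    rw [hEi] at h1
    exact hcast (natCast_choose_prime_pow_eq_zero_of_pow_dvd p K hk h1)
  have hnot : ¬ IsPthPowerExponent q E := fun h =>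
    hnoti ((isPthPowerExponent_iff q E).mp h i)
  have hEj : E j = w - m * q := by
    rw [hEdef, Finsupp.add_apply, Finsupp.single_apply, if_neg hij, add_zero, hE'j, hρj]
  refine ⟨E, ?_, hEj, hnoti, ?_⟩
  · rw [MvPolynomial.mem_support_iff, coeff_deletePthPowers, if_neg hnot]
    exact hcoeff
  · have hEdeg : E.degree = E'.degree + a := by
      rw [hEdef, map_add, Finsupp.degree_single]
    rw [hEdeg]
    omega

omit hp [CharP K p] in
/-- **The package when `q ∤ w`**: no probe is needed — every monomial of the lowest layer
`E_j = w − m·q ≢ 0 (mod q)` survives the cleaning ("If `ω(F)` is not divisible by `pᵉ`, then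
`G = 0` and `in_{ω₁}(F₁) = in_ω(F)`"). Any natural number `q`. [cite: HauserPerlega2024, Lemma 2 p. 790 (case pᵉ ∤ ord_ω(F))] -/
theorem exists_support_package_of_not_dvd (q : ℕ) (j : σ) (b : σ → K) (hbj : b j = 0)
    (m : ℕ) {P : MvPolynomial σ K} (hP0 : P ≠ 0) {w : ℕ} (hw : ∀ d ∈ P.support, pkgWeight j m d = w)
    (hmq : m * q ≤ w) (hqw : ¬ q ∣ w)
    (ρ : σ →₀ ℕ) (hρj : ρ j = w - m * q) (hρ : ∀ d ∈ P.support, ρ ≤ pkgExponent q j m d)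
    (D : ℕ) (hD : ∀ d ∈ P.support, (pkgExponent q j m d).degree ≤ ρ.degree + D) :
    ∃ E ∈ (deletePthPowers q (translate b (pkgTransform q j m P))).support,
      E j = w - m * q ∧ E.degree ≤ (ρ.filter (fun l => b l = 0)).degree + D := by
  have hPw : ∀ d ∈ P.support, m * q ≤ pkgWeight j m d := fun d hd => by rw [hw d hd]; exact hmq
  have hρle : ∀ e' ∈ (pkgTransform q j m P).support, ρ ≤ e' := by
    intro e' he
    obtain ⟨d, hd, rfl⟩ := exists_of_mem_support_pkgTransform he
    exact hρ d hd
  have hD' : ∀ e' ∈ (pkgTransform q j m P).support, e' j = ρ j → e'.degree ≤ ρ.degree + D := by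
    intro e' he _
    obtain ⟨d, hd, rfl⟩ := exists_of_mem_support_pkgTransform he
    exact hD d hd
  obtain ⟨d₀, hd₀⟩ := MvPolynomial.ne_zero_iff.mp hP0
  have hd₀s : d₀ ∈ P.support := MvPolynomial.mem_support_iff.mpr hd₀
  have hlayer : ∃ e' ∈ (pkgTransform q j m P).support, e' j = ρ j := by
    refine ⟨pkgExponent q j m d₀, ?_, ?_⟩
    · rw [MvPolynomial.mem_support_iff, coeff_pkgTransform hPw hd₀s]; exact hd₀
    · rw [pkgExponent_apply, if_pos rfl, hw d₀ hd₀s, hρj]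
  obtain ⟨E, hE, hEj, hEdeg⟩ :=
    exists_mem_support_translate_layer b hbj (pkgTransform q j m P) ρ hρle D hD' hlayer
  have hnot : ¬ IsPthPowerExponent q E := by
    intro h
    have h1 : q ∣ E j := (isPthPowerExponent_iff q E).mp h j
    rw [hEj, hρj] at h1
    apply hqw
    have h2 : q ∣ w - m * q + m * q := dvd_add h1 (dvd_mul_left q m)
    rwa [Nat.sub_add_cancel hmq] at h2
  refine ⟨E, ?_, by rw [hEj, hρj], hEdeg⟩
  rw [MvPolynomial.mem_support_iff, coeff_deletePthPowers, if_neg hnot]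
  exact MvPolynomial.mem_support_iff.mp hE

end Probe

/-! ## 7. Two residual variables (surfaces `z^{pᵉ} + F(x,y)`): Hauser–Perlega's Lemma 2 and the
## residual order at the end of the package -/

section TwoLetters

variable {σ : Type*} [Fintype σ] [DecidableEq σ]

/-- With two letters, `univ ∖ {j} = {i}`. [folklore] -/
private theorem univ_erase_eq_singleton {j i : σ} (hij : i ≠ j) (hσ : ∀ l, l = j ∨ l = i) :
    (univ : Finset σ).erase j = {i} := by
  ext l
  rw [Finset.mem_erase, Finset.mem_singleton]
  constructor
  · rintro ⟨hl, -⟩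
    rcases hσ l with h | h
    · exact (hl h).elim
    · exact h
  · rintro rfl
    exact ⟨hij, Finset.mem_univ _⟩

/-- With two letters, `|f| = f_j + f_i`. [folklore] -/
private theorem degree_eq_two {j i : σ} (hij : i ≠ j) (hσ : ∀ l, l = j ∨ l = i) (f : σ →₀ ℕ) :
    f.degree = f j + f i := by
  rw [degree_eq_add_sum_erase j f, univ_erase_eq_singleton hij hσ, Finset.sum_singleton]

/-- With two letters, `w_m(d) = d_j + m·d_i` ("`ω(x^i y^j) = i + jn`").
[cite: HauserPerlega2024, §4 p. 781 (weighted order)] -/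
theorem pkgWeight_eq_two {j i : σ} (hij : i ≠ j) (hσ : ∀ l, l = j ∨ l = i) (m : ℕ) (d : σ →₀ ℕ) :
    pkgWeight j m d = d j + m * d i := by
  rw [pkgWeight_eq_add_mul_sum, univ_erase_eq_singleton hij hσ, Finset.sum_singleton]

variable {K : Type*} [Field K]

section Level

variable (p : ℕ) [hp : Fact p.Prime]

omit [Fintype σ] [DecidableEq σ] hp in
/-- **The level of the probe.** For a non-zero polynomial none of whose monomials is a `pᵉ`-th power
exponent there is `k < e` such that every exponent is divisible by `p^k` and some exponent is not
divisible by `p^{k+1}` ("Let `k < e` be maximal with the property that `in_ω(F)` is a `p^k`-th power").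
[cite: HauserPerlega2024, Lemma 2 p. 790 (choice of k)] -/
theorem exists_level {e : ℕ} {P : MvPolynomial σ K} (hP0 : P ≠ 0)
    (hclean : ∀ d ∈ P.support, ¬ IsPthPowerExponent (p ^ e) d) :
    ∃ k, k < e ∧ (∀ d ∈ P.support, ∀ l, p ^ k ∣ d l) ∧
      ∃ d ∈ P.support, ∃ l, ¬ p ^ (k + 1) ∣ d l := by
  classical
  obtain ⟨d₁, hd₁⟩ := MvPolynomial.ne_zero_iff.mp hP0
  have hd₁s : d₁ ∈ P.support := MvPolynomial.mem_support_iff.mpr hd₁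
  obtain ⟨l₁, hl₁⟩ : ∃ l, ¬ p ^ e ∣ d₁ l := by
    have h := hclean d₁ hd₁s
    rw [isPthPowerExponent_iff] at h
    push Not at h
    exact h
  have he : 1 ≤ e := by
    by_contra h0
    have : e = 0 := by omega
    subst this
    exact hl₁ (by rw [pow_zero]; exact one_dvd _)
  have hQ : ∃ k, ∃ d ∈ P.support, ∃ l, ¬ p ^ (k + 1) ∣ d l :=
    ⟨e - 1, d₁, hd₁s, l₁, by rw [Nat.sub_add_cancel he]; exact hl₁⟩
  refine ⟨Nat.find hQ, ?_, ?_, Nat.find_spec hQ⟩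
  · have h := Nat.find_min' hQ (m := e - 1) ⟨d₁, hd₁s, l₁, by rw [Nat.sub_add_cancel he]; exact hl₁⟩
    omega
  · intro d hd l
    rcases Nat.eq_zero_or_eq_succ_pred (Nat.find hQ) with h0 | hsucc
    · rw [h0, pow_zero]; exact one_dvd _
    · have hmin := Nat.find_min hQ (m := (Nat.find hQ).pred) (by omega)
      push Not at hmin
      have := hmin d hd l
      have e1 : (Nat.find hQ).pred + 1 = Nat.find hQ := by omega
      rwa [e1] at this

variable [CharP K p]

/-- **"`∂_{y^{p^k}}(in_ω(F))` does not vanish."** Two letters `j` (the chart, weight `1`) and `i`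
(weight `m`): if `P` is weighted-homogeneous of weight `w` with `p^{k+1} ∣ w`, all its exponents are
divisible by `p^k` and one is not divisible by `p^{k+1}`, then some monomial `y^d` of `P` has
`(d_i choose p^k) ≢ 0 (mod p)` — for otherwise `p^{k+1}` divides every `d_i`, hence (weight) every
`d_j`. [cite: HauserPerlega2024, Lemma 2 p. 790 ("It is straightforward to verify that the derivative does not vanish")] -/
theorem exists_choose_ne_zero_of_weight {j i : σ} (hij : i ≠ j) (hσ : ∀ l, l = j ∨ l = i)
    {m : ℕ} {P : MvPolynomial σ K} {w k : ℕ} (hw : ∀ d ∈ P.support, pkgWeight j m d = w)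
    (hpw : p ^ (k + 1) ∣ w) (hall : ∀ d ∈ P.support, ∀ l, p ^ k ∣ d l)
    (hnot : ∃ d ∈ P.support, ∃ l, ¬ p ^ (k + 1) ∣ d l) :
    ∃ d ∈ P.support, ((d i).choose (p ^ k) : K) ≠ 0 := by
  by_contra H
  push Not at H
  have hdi : ∀ d ∈ P.support, p ^ (k + 1) ∣ d i := by
    intro d hd
    have h1 : p ∣ d i / p ^ k := (natCast_choose_prime_pow_eq_zero_iff p K (d i) k).mp (H d hd)
    obtain ⟨t, ht⟩ := h1
    have h2 : d i = p ^ k * (d i / p ^ k) := (Nat.mul_div_cancel' (hall d hd i)).symm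
    rw [h2, ht, pow_succ]
    exact mul_dvd_mul_left _ (dvd_mul_right p t)
  have hdj : ∀ d ∈ P.support, p ^ (k + 1) ∣ d j := by
    intro d hd
    have h1 := hw d hd
    rw [pkgWeight_eq_two hij hσ] at h1
    have h2 : p ^ (k + 1) ∣ d j + m * d i := by rw [h1]; exact hpw
    exact (Nat.dvd_add_left (dvd_mul_of_dvd_right (hdi d hd) m)).mp h2
  obtain ⟨d, hd, l, hl⟩ := hnot
  rcases hσ l with rfl | rfl
  · exact hl (hdj d hd)
  · exact hl (hdi d hd)

end Level

variable [DecidableEq K] (p : ℕ) [hp : Fact p.Prime] [CharP K p]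

/-- **The package bound with the probe at level `p^k`** (two letters; [HP24, Lemma 2] with its proof,
and §4 p. 781, in fixed coordinates). Surface `z^{pᵉ} + F(y_j, y_i)`; the PACKAGE: `m − 1` point
blow-ups at the origin of the `y_j`-chart, then one at the point `b` of the `y_j`-chart OFF the strict
transform of `{y_i = 0}` (`b_i ≠ 0`), the order staying `≥ q = pᵉ`; `P = in_ω(F)` the weighted initial
form for `ω(y_j) = 1`, `ω(y_i) = m`. If `β ≤ d_i ≤ D` for the monomials `y^d` of `P` with
`(d_i choose p^k) ≢ 0 (mod p)` (`k < e`, at least one such), then the shade at the end of the package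
is `≤ (D − β) + p^k` — "`d′_res ≤ d_curv ≤ ord H + p^k`", `in_ω(F) = x^a y^b·H`, `ord H = deg_y H`.
[cite: HauserPerlega2024, Lemma 2 p. 789–790] [cite: HauserPerlega2024, §4 p. 781 (d̃ bounds the residual order at the end of the sequence)] -/
theorem shade_package_le_of_choose_ne_zero {e : ℕ} {j i : σ} (hij : i ≠ j) (hσ : ∀ l, l = j ∨ l = i)
    {m : ℕ} (hm : 1 ≤ m) (s : ℕ → State σ K) (b : σ → K) (hbj : b j = 0) (hbi : b i ≠ 0)
    (hstep : ∀ n, n + 1 < m → s (n + 1) = step (p ^ e) j 0 (s n))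
    (hlast : s m = step (p ^ e) j b (s (m - 1)))
    (hF0 : (s 0).F ≠ 0) (hclean : deletePthPowers (p ^ e) (s 0).F = (s 0).F)
    (hord : ∀ n, n < m → ((p ^ e : ℕ) : ℕ∞) ≤ ordZero (s n).F)
    {k : ℕ} (hk : k < e) {β D : ℕ}
    (hβD : ∀ d ∈ (pkgInitial j m (s 0).F).support, ((d i).choose (p ^ k) : K) ≠ 0 →
      β ≤ d i ∧ d i ≤ D)
    (hex : ∃ d ∈ (pkgInitial j m (s 0).F).support, ((d i).choose (p ^ k) : K) ≠ 0) :
    (s m).shade ≤ ((D - β + p ^ k : ℕ) : ℕ∞) := by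
  obtain ⟨hFm, hle, hmq, hrdeg⟩ :=
    package_closed_form (p ^ e) j hm s b hbj hstep hlast hF0 hclean hord
  have hempty : (univ.erase j).filter (fun l : σ => b l = 0) = ∅ := by
    rw [univ_erase_eq_singleton hij hσ]
    ext l
    simp only [Finset.mem_filter, Finset.mem_singleton, Finset.notMem_empty, iff_false, not_and]
    rintro rfl
    exact hbi
  rw [hempty, Finset.sum_empty, add_zero] at hrdeg
  set F : MvPolynomial σ K := (s 0).F with hFdef
  set w₀ : ℕ := minPkgWeight j m F with hw₀def
  set P : MvPolynomial σ K := pkgInitial j m F with hPdef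
  obtain ⟨d₀, hd₀, hd₀i⟩ := hex
  have hPw : ∀ d ∈ P.support, pkgWeight j m d = w₀ := fun d hd => (mem_support_pkgInitial.mp hd).2
  have hchoose_le : ∀ d : σ →₀ ℕ, ((d i).choose (p ^ k) : K) ≠ 0 → p ^ k ≤ d i := by
    intro d hd
    by_contra hlt
    exact hd (by rw [Nat.choose_eq_zero_of_lt (not_le.mp hlt), Nat.cast_zero])
  -- the multiplicity vector of the layer lemma and the slack
  set ρ : σ →₀ ℕ := Finsupp.single j (w₀ - m * p ^ e) + Finsupp.single i (β - p ^ k) with hρdef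
  have hρj : ρ j = w₀ - m * p ^ e := by
    rw [hρdef, Finsupp.add_apply, Finsupp.single_eq_same, Finsupp.single_apply, if_neg hij, add_zero]
  have hρi : ρ i = β - p ^ k := by
    rw [hρdef, Finsupp.add_apply, Finsupp.single_apply, if_neg (Ne.symm hij), Finsupp.single_eq_same,
      zero_add]
  have hρdeg : ρ.degree = (w₀ - m * p ^ e) + (β - p ^ k) := by rw [degree_eq_two hij hσ, hρj, hρi]
  have hρ : ∀ d ∈ P.support, ((d i).choose (p ^ k) : K) ≠ 0 →
      ρ + Finsupp.single i (p ^ k) ≤ pkgExponent (p ^ e) j m d := by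
    intro d hd hdi
    rw [Finsupp.le_def]
    intro l
    rw [Finsupp.add_apply, pkgExponent_apply]
    rcases hσ l with rfl | rfl
    · rw [if_pos rfl, hρj, Finsupp.single_apply, if_neg hij, add_zero, hPw d hd]
    · rw [if_neg hij, hρi, Finsupp.single_eq_same]
      have h1 := (hβD d hd hdi).1
      have h2 := hchoose_le d hdi
      omega
  have hD : ∀ d ∈ P.support, ((d i).choose (p ^ k) : K) ≠ 0 →
      (pkgExponent (p ^ e) j m d).degree ≤ ρ.degree + p ^ k + (D - (β - p ^ k + p ^ k)) := by
    intro d hd hdi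
    rw [degree_eq_two hij hσ, pkgExponent_apply, if_pos rfl, pkgExponent_apply, if_neg hij,
      hPw d hd, hρdeg]
    have h1 := (hβD d hd hdi).2
    omega
  obtain ⟨E, hE, hEj, -, hEdeg⟩ := exists_support_package_of_choose_ne_zero p j b hbj m P hPw
    hmq hij hk hd₀ hd₀i ρ hρj hρ (D - (β - p ^ k + p ^ k)) hD
  have hnot : ¬ IsPthPowerExponent (p ^ e) E := fun h =>
    (MvPolynomial.mem_support_iff.mp hE) (by rw [coeff_deletePthPowers, if_pos h])
  have hEF : E ∈ (s m).F.support := by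
    rw [hFm, MvPolynomial.mem_support_iff, coeff_deletePthPowers, if_neg hnot,
      coeff_translate_pkgTransform_layer (p ^ e) j b hbj m hle hEj]
    have h := MvPolynomial.mem_support_iff.mp hE
    rwa [coeff_deletePthPowers, if_neg hnot] at h
  have hfilt : (ρ.filter (fun l => b l = 0)).degree = w₀ - m * p ^ e := by
    rw [degree_eq_two hij hσ, Finsupp.filter_apply, if_pos hbj, Finsupp.filter_apply, if_neg hbi,
      hρj, add_zero]
  have hEdeg' : E.degree ≤ (w₀ - m * p ^ e) + (D - (β - p ^ k + p ^ k)) + p ^ k := by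
    rw [hfilt] at hEdeg; exact hEdeg
  have hrdeg' : (s m).r.degree = w₀ - m * p ^ e := hrdeg
  have hbound : E.degree ≤ (s m).r.degree + (D - β + p ^ k) := by
    rw [hrdeg']; omega
  exact shade_le_of_mem_support (s m) hEF hbound

omit hp [CharP K p] in
/-- **The package bound when `q ∤ w₀`** (two letters; [HP24, Lemma 2], case "`pᵉ` does not divide
`ord_ω(F)`": "then `G = 0` … `d_curv = ord_{(y₁)} in_ω(F) ≤ ord H`"): if `β ≤ d_i ≤ D` for all
monomials `y^d` of `in_ω(F)`, the shade at the end of the package is `≤ D − β`. Any natural `q`.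
[cite: HauserPerlega2024, Lemma 2 p. 790 (case pᵉ ∤ ord_ω(F))] [cite: HauserPerlega2024, §4 p. 781] -/
theorem shade_package_le_of_not_dvd (q : ℕ) {j i : σ} (hij : i ≠ j) (hσ : ∀ l, l = j ∨ l = i)
    {m : ℕ} (hm : 1 ≤ m) (s : ℕ → State σ K) (b : σ → K) (hbj : b j = 0) (hbi : b i ≠ 0)
    (hstep : ∀ n, n + 1 < m → s (n + 1) = step q j 0 (s n))
    (hlast : s m = step q j b (s (m - 1)))
    (hF0 : (s 0).F ≠ 0) (hclean : deletePthPowers q (s 0).F = (s 0).F)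
    (hord : ∀ n, n < m → (q : ℕ∞) ≤ ordZero (s n).F)
    (hqw : ¬ q ∣ minPkgWeight j m (s 0).F) {β D : ℕ}
    (hβD : ∀ d ∈ (pkgInitial j m (s 0).F).support, β ≤ d i ∧ d i ≤ D) :
    (s m).shade ≤ ((D - β : ℕ) : ℕ∞) := by
  set F : MvPolynomial σ K := (s 0).F with hFdef
  set w₀ : ℕ := minPkgWeight j m F with hw₀def
  set P : MvPolynomial σ K := pkgInitial j m F with hPdef
  obtain ⟨hFm, hle, hmq, hrdeg⟩ := package_closed_form q j hm s b hbj hstep hlast hF0 hclean hord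
  have hempty : (univ.erase j).filter (fun l : σ => b l = 0) = ∅ := by
    rw [univ_erase_eq_singleton hij hσ]
    ext l
    simp only [Finset.mem_filter, Finset.mem_singleton, Finset.notMem_empty, iff_false, not_and]
    rintro rfl
    exact hbi
  rw [hempty, Finset.sum_empty, add_zero] at hrdeg
  have hP0 : P ≠ 0 := pkgInitial_ne_zero j m hF0
  have hPw : ∀ d ∈ P.support, pkgWeight j m d = w₀ := fun d hd => (mem_support_pkgInitial.mp hd).2
  set ρ : σ →₀ ℕ := Finsupp.single j (w₀ - m * q) + Finsupp.single i β with hρdef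
  have hρj : ρ j = w₀ - m * q := by
    rw [hρdef, Finsupp.add_apply, Finsupp.single_eq_same, Finsupp.single_apply, if_neg hij, add_zero]
  have hρi : ρ i = β := by
    rw [hρdef, Finsupp.add_apply, Finsupp.single_apply, if_neg (Ne.symm hij), Finsupp.single_eq_same,
      zero_add]
  have hρdeg : ρ.degree = (w₀ - m * q) + β := by rw [degree_eq_two hij hσ, hρj, hρi]
  have hρ : ∀ d ∈ P.support, ρ ≤ pkgExponent q j m d := by
    intro d hd
    rw [Finsupp.le_def]
    intro l
    rw [pkgExponent_apply]
    rcases hσ l with rfl | rfl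
    · rw [if_pos rfl, hρj, hPw d hd]
    · rw [if_neg hij, hρi]; exact (hβD d hd).1
  have hD : ∀ d ∈ P.support, (pkgExponent q j m d).degree ≤ ρ.degree + (D - β) := by
    intro d hd
    rw [degree_eq_two hij hσ, pkgExponent_apply, if_pos rfl, pkgExponent_apply, if_neg hij,
      hPw d hd, hρdeg]
    have h1 := hβD d hd
    omega
  obtain ⟨E, hE, hEj, hEdeg⟩ :=
    exists_support_package_of_not_dvd q j b hbj m hP0 hPw hmq hqw ρ hρj hρ (D - β) hD
  have hnot : ¬ IsPthPowerExponent q E := fun h =>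
    (MvPolynomial.mem_support_iff.mp hE) (by rw [coeff_deletePthPowers, if_pos h])
  have hEF : E ∈ (s m).F.support := by
    rw [hFm, MvPolynomial.mem_support_iff, coeff_deletePthPowers, if_neg hnot,
      coeff_translate_pkgTransform_layer q j b hbj m hle hEj]
    have h := MvPolynomial.mem_support_iff.mp hE
    rwa [coeff_deletePthPowers, if_neg hnot] at h
  have hfilt : (ρ.filter (fun l => b l = 0)).degree = w₀ - m * q := by
    rw [degree_eq_two hij hσ, Finsupp.filter_apply, if_pos hbj, Finsupp.filter_apply, if_neg hbi,
      hρj, add_zero]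
  rw [hfilt] at hEdeg
  refine shade_le_of_mem_support (s m) hEF (m := D - β) ?_
  rw [hrdeg]; omega

/-- **Hauser–Perlega's Lemma 2 with the end-of-package estimate of §4, in fixed coordinates, every
`e ≥ 1`** (two letters `y_j`, `y_i`; surface `z^{pᵉ} + F(y_j, y_i)`, `F ≠ 0` clean). Along the
package — `m − 1` point blow-ups at the origin of the `y_j`-chart followed by one at a point `b` of the
`y_j`-chart with `b_i ≠ 0` (the component `{y_i = 0}` is preserved `m − 1` times and then lost
together with the last `{y_j = 0}`), the order staying `≥ pᵉ` — the shade at the end satisfies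
`shade ≤ (D − β) + p^{e−1}` whenever `β ≤ d_i ≤ D` on the monomials `y^d` of the weighted initial
form `in_ω(F)`, `ω(y_j) = 1`, `ω(y_i) = m`: "`d_curv^F ≤ ord H + p^{e−1}` if `pᵉ` divides `ord_ω(F)`,
`ord H` otherwise", `in_ω(F) = x^a y^b·H` (so `ord H = deg_y H = max_y − min_y` of `in_ω(F)`), and
"`d̃` bounds the residual order of the final strict transform at the end of the sequence of
localized point blowups". [cite: HauserPerlega2024, Lemma 2 p. 789] [cite: HauserPerlega2024, §4 pp. 780–781] -/
theorem shade_package_le {e : ℕ} {j i : σ} (hij : i ≠ j) (hσ : ∀ l, l = j ∨ l = i)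
    {m : ℕ} (hm : 1 ≤ m) (s : ℕ → State σ K) (b : σ → K) (hbj : b j = 0) (hbi : b i ≠ 0)
    (hstep : ∀ n, n + 1 < m → s (n + 1) = step (p ^ e) j 0 (s n))
    (hlast : s m = step (p ^ e) j b (s (m - 1)))
    (hF0 : (s 0).F ≠ 0) (hclean : deletePthPowers (p ^ e) (s 0).F = (s 0).F)
    (hord : ∀ n, n < m → ((p ^ e : ℕ) : ℕ∞) ≤ ordZero (s n).F) {β D : ℕ}
    (hβD : ∀ d ∈ (pkgInitial j m (s 0).F).support, β ≤ d i ∧ d i ≤ D) :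
    (s m).shade ≤ ((D - β + p ^ (e - 1) : ℕ) : ℕ∞) := by
  by_cases hqw : p ^ e ∣ minPkgWeight j m (s 0).F
  · -- the probe at the level `p^k`, `k < e` maximal with `in_ω(F)` a `p^k`-th power
    set P : MvPolynomial σ K := pkgInitial j m (s 0).F with hPdef
    have hP0 : P ≠ 0 := pkgInitial_ne_zero j m hF0
    have hPclean : ∀ d ∈ P.support, ¬ IsPthPowerExponent (p ^ e) d := fun d hd =>
      not_isPthPowerExponent_of_mem_support_pkgInitial (p ^ e) hclean hd
    obtain ⟨k, hk, hall, hnot⟩ := exists_level p hP0 hPclean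
    have hPw : ∀ d ∈ P.support, pkgWeight j m d = minPkgWeight j m (s 0).F := fun d hd =>
      (mem_support_pkgInitial.mp hd).2
    have hpw : p ^ (k + 1) ∣ minPkgWeight j m (s 0).F :=
      dvd_trans (pow_dvd_pow p (by omega)) hqw
    obtain ⟨d₀, hd₀, hd₀i⟩ := exists_choose_ne_zero_of_weight p hij hσ hPw hpw hall hnot
    have h := shade_package_le_of_choose_ne_zero p hij hσ hm s b hbj hbi hstep hlast hF0 hclean hord
      hk (fun d hd _ => hβD d hd) ⟨d₀, hd₀, hd₀i⟩
    refine le_trans h ?_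
    have : p ^ k ≤ p ^ (e - 1) := Nat.pow_le_pow_right hp.out.pos (by omega)
    exact_mod_cast (by omega : D - β + p ^ k ≤ D - β + p ^ (e - 1))
  · have h := shade_package_le_of_not_dvd (p ^ e) hij hσ hm s b hbj hbi hstep hlast hF0 hclean hord
      hqw hβD
    refine le_trans h ?_
    exact_mod_cast (Nat.le_add_right _ _)

omit [DecidableEq K] hp [CharP K p] in
/-- `ord H ≤ d_res`: for two letters and `m ≥ 1`, every monomial `y^d` of the weighted initial form
satisfies `d_i + r_j ≤ ord₀ F` — so with `β ≥ r_i` the quantity `D − β` of the package bound is at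
most the shade `ord₀ F − r_j − r_i` at the START of the package (the package bound refines the
step-by-step bound `+p^{e−1}`). [cite: HauserPerlega2024, §4 p. 780 (d_t ≤ d_res + p^{e−1}; ord H ≤ d_res implicit)] -/
theorem apply_add_le_of_mem_support_pkgInitial {j i : σ} (hij : i ≠ j) (hσ : ∀ l, l = j ∨ l = i)
    {m : ℕ} (hm : 1 ≤ m) (s : State σ K) {o : ℕ} (ho : ordZero s.F = o)
    (hr : ∀ d ∈ s.F.support, s.r ≤ d) {d : σ →₀ ℕ} (hd : d ∈ (pkgInitial j m s.F).support) :
    d i + s.r j ≤ o := by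
  obtain ⟨⟨ds, hds, hdsdeg⟩, -⟩ := (ordZero_eq_nat_iff _ _).mp ho
  have hdss : ds ∈ s.F.support := MvPolynomial.mem_support_iff.mpr hds
  obtain ⟨hdF, hdw⟩ := mem_support_pkgInitial.mp hd
  have h1 : pkgWeight j m d ≤ pkgWeight j m ds := by rw [hdw]; exact minPkgWeight_le j m hdss
  rw [pkgWeight_eq_two hij hσ, pkgWeight_eq_two hij hσ] at h1
  rw [degree_eq_two hij hσ] at hdsdeg
  have hr1 : s.r j ≤ d j := Finsupp.le_def.mp (hr d hdF) j
  have hr2 : s.r j ≤ ds j := Finsupp.le_def.mp (hr ds hdss) j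
  have h3 : (m - 1) * s.r j ≤ (m - 1) * ds j := Nat.mul_le_mul_left _ hr2
  have h4 : m * (d i + s.r j) ≤ m * (ds j + ds i) := by
    have hm' : m = (m - 1) + 1 := by omega
    rw [hm']
    rw [hm'] at h1
    nlinarith [h1, hr1, h3]
  have h5 := Nat.le_of_mul_le_mul_left h4 (by omega)
  omega

/-- **Consequently the package never ends above `shade₀ + p^{e−1}`** (two letters; `shade₀` the
shade at the start, `y^{r} ∣ F`): the instance `β = r_i`, `D = max_d d_i` of `shade_package_le`,
using `ord H ≤ d_res`. (This much also follows from the one-step bound of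
`PointBlowupMohBoundPrimePower.mohBound` since the `m − 1` blow-ups at the origin lose one component
each and do not raise the shade; the content of Lemma 2 is the sharper `D − β`.)
[cite: HauserPerlega2024, §4 p. 780 ("d′_res ≤ d_t … d_t ≤ d_res + p^{e−1}")] [cite: Moh1987, Stability Theorem] -/
theorem shade_package_le_shade_add {e : ℕ} {j i : σ} (hij : i ≠ j) (hσ : ∀ l, l = j ∨ l = i)
    {m : ℕ} (hm : 1 ≤ m) (s : ℕ → State σ K) (b : σ → K) (hbj : b j = 0) (hbi : b i ≠ 0)
    (hstep : ∀ n, n + 1 < m → s (n + 1) = step (p ^ e) j 0 (s n))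
    (hlast : s m = step (p ^ e) j b (s (m - 1)))
    (hF0 : (s 0).F ≠ 0) (hclean : deletePthPowers (p ^ e) (s 0).F = (s 0).F)
    (hr : ∀ d ∈ (s 0).F.support, (s 0).r ≤ d)
    (hord : ∀ n, n < m → ((p ^ e : ℕ) : ℕ∞) ≤ ordZero (s n).F) :
    (s m).shade ≤ (s 0).shade + ((p ^ (e - 1) : ℕ) : ℕ∞) := by
  set P : MvPolynomial σ K := pkgInitial j m (s 0).F with hPdef
  have hP0 : P ≠ 0 := pkgInitial_ne_zero j m hF0
  have hPne : P.support.Nonempty := MvPolynomial.support_nonempty.mpr hP0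
  set D : ℕ := P.support.sup (fun d => d i) with hDdef
  obtain ⟨dm, hdm, hdmD⟩ := Finset.exists_mem_eq_sup P.support hPne (fun d => d i)
  have hβD : ∀ d ∈ P.support, (s 0).r i ≤ d i ∧ d i ≤ D := fun d hd =>
    ⟨Finsupp.le_def.mp (hr d (mem_support_pkgInitial.mp hd).1) i,
      Finset.le_sup (f := fun d => d i) hd⟩
  have h := shade_package_le p hij hσ hm s b hbj hbi hstep hlast hF0 hclean hord hβD
  refine le_trans h ?_
  -- `D − r_i ≤ shade₀`
  have hne : ordZero (s 0).F ≠ ⊤ := by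
    unfold ordZero
    rw [Ne, MvPowerSeries.order_eq_top_iff, MvPolynomial.coe_eq_zero_iff]
    exact hF0
  obtain ⟨o, ho⟩ := WithTop.ne_top_iff_exists.mp hne
  have ho' : ordZero (s 0).F = o := ho.symm
  have hDo : D + (s 0).r j ≤ o := by
    rw [hDdef, hdmD]
    exact apply_add_le_of_mem_support_pkgInitial hij hσ hm (s 0) ho' hr hdm
  rw [shade_eq_of_ordZero_eq (s 0) ho', degree_eq_two hij hσ, ← ENat.coe_add]
  exact_mod_cast (by omega : D - (s 0).r i + p ^ (e - 1) ≤ o - ((s 0).r j + (s 0).r i) + p ^ (e - 1))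

end TwoLetters

end PointBlowup

end Literature.AlgebraicGeometry.Resolution

end
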